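import Mathlib
import Literature.NumberTheory.LFunctions.Zhang2022.Section8cStatements
import Literature.NumberTheory.Sieve.CoprimeTotientLogSum
import HarnessLib

/-!
# Zhang (2022) §8 p. 48 — the `[T, 1.2.12]` display (`Z22:§8.u048`): the constant identity, and the
# twisted totient mean value with a polynomial-in-`𝓛` error, on the typed sum of `Section8cStatements`

Topic `Literature/NumberTheory/LFunctions/Zhang2022` (Landau–Siegel audit tree; verdict-neutral).
Y. Zhang, *Discrete mean estimates and the Landau–Siegel zero*, arXiv:2211.02515v1 (2022)
[Zhang2022LandauSiegel] — **an unrefereed manuscript under adjudication** (D-0069 campaign, cell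
`siegel-zhang`, discharge seat d16). The display before (8.11), p. 48 (tex L2463):
"for `x < P`, `Σ_{n<x}|χ(n)|φ(n)/n² = (φ(D)/D)(∏_{(q,D)=1}(1 − q⁻²)) log x + O(log 𝓛)
 = (6/π²)(∏_{q∣D} q/(q+1)) log x + O(log 𝓛)` (see [T, 1.2.12])", typed (slice L2-t8) as
`Section8cStatements.Step8u048` (the mean value, error `C log 𝓛`) and `Step8u048const` (equality of
the two constants). PROVED here:

* `step8u048const_holds : Step8u048const` — DISCHARGED, from the tree's
  `Sieve.CoprimeTotient.totientLogDensity_eq_mul_tprod` (`Sieve/CoprimeTotientLogSum.lean`).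
* `step8u048_weak` — the mean value with error `24𝓛²` for `x ≥ 1`, `D ≥ 3`: the tree's
  `Sieve.CoprimeTotient.abs_sum_norm_mul_totient_div_sq_sub_le` (error `3(1 + log D)² + 11`,
  uniformly in `x ≥ 1`), restated on the typed sum over `1 ≤ n < x` (`n ∈ Ico 1 ⌈x⌉`;
  `sum_Icc_floor_sub_sum_Ico_ceil` compares it with the tree's `n ∈ Icc 1 ⌊x⌋`: they differ by the
  single term `n = x`, present iff `x ∈ ℕ`, of size `≤ 1`).

The PRINTED error `O(log 𝓛)` is NOT proved here, so `Step8u048` as typed is NOT discharged by this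
file (campaign GAP row G-d16-1: the consumer, the partial integration giving (8.11), needs only an
error `o(𝓛⁹) = o(log P)`, which `step8u048_weak` supplies).

WHAT THIS IS NOT: any claim about Theorems 1–2 of the manuscript or about Landau–Siegel zeros;
a proof of the printed `O(log 𝓛)`.

## References

* Y. Zhang, arXiv:2211.02515v1 (2022), §8 p. 48, display before (8.11) (tex L2463); (2.31).
  [cite: Zhang2022LandauSiegel, §8 p.48]
* E. C. Titchmarsh, *The Theory of the Riemann Zeta-Function*, 2nd ed. (1986), (1.2.12) — `[T]`.
-/

noncomputable section

open Complex Real ComplexConjugate Set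

namespace Literature.NumberTheory.LFunctions.Zhang2022.Section8cProofs

open Literature.NumberTheory.LFunctions.Zhang2022.Skeleton

/-! ## `Z22:§8.u048`: the constant, and the mean value with a polynomial-in-`𝓛` error -/

/-- **`Z22:§8.u048` (the constant), DISCHARGED**: the two printed main-term constants agree,
`(φ(D)/D)∏_{(q,D)=1}(1 − q⁻²) = (6/π²)∏_{q∣D} q/(q+1)` — the tree's
`Sieve.CoprimeTotient.totientLogDensity_eq_mul_tprod`. [cite: Zhang2022LandauSiegel, §8 p.48 display before (8.11), tex L2463] -/
theorem step8u048const_holds : Section8cStatements.Step8u048const := by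
  intro D hD
  rw [← Literature.NumberTheory.Sieve.CoprimeTotient.totientLogDensity_eq_mul_tprod hD,
    Literature.NumberTheory.Sieve.CoprimeTotient.totientLogDensity_def]

/-- `Step8u048const` — `_holds` alias of `step8u048const_holds` above under the fact's exact name (appended
2026-08-28, D-0026 bookkeeping: the proof term is the existing theorem of this file; no statement,
definition or attribute is edited; no new named fact; the ledger's debt table listed the fact
unproved). [cite: Zhang2022LandauSiegel, §8 p.48 display before (8.11), tex L2463] -/
theorem _root_.Literature.NumberTheory.LFunctions.Zhang2022.Section8cStatements.Step8u048const_holds :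
    Section8cStatements.Step8u048const :=
  _root_.Literature.NumberTheory.LFunctions.Zhang2022.Section8cProofs.step8u048const_holds

/-- The typed sum of `Z22:§8.u048` (over `1 ≤ n < x`, i.e. `n ∈ Ico 1 ⌈x⌉`) and the tree's sum
(over `n ∈ Icc 1 ⌊x⌋`) differ by at most the single term `n = x` (present iff `x ∈ ℕ`), which is
`≤ 1`. [cite: Zhang2022LandauSiegel, §8 p.48 display before (8.11), tex L2463] -/
theorem sum_Icc_floor_sub_sum_Ico_ceil {D : ℕ} (χ : DirichletCharacter ℂ D) {x : ℝ} (hx : 1 ≤ x) :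
    0 ≤ (∑ n ∈ Finset.Icc 1 ⌊x⌋₊, ‖χ n‖ * ((Nat.totient n : ℝ) / (n : ℝ) ^ 2)) -
        (∑ n ∈ Finset.Ico 1 ⌈x⌉₊, ‖χ (n : ZMod D)‖ * (Nat.totient n : ℝ) / (n : ℝ) ^ 2) ∧
      (∑ n ∈ Finset.Icc 1 ⌊x⌋₊, ‖χ n‖ * ((Nat.totient n : ℝ) / (n : ℝ) ^ 2)) -
        (∑ n ∈ Finset.Ico 1 ⌈x⌉₊, ‖χ (n : ZMod D)‖ * (Nat.totient n : ℝ) / (n : ℝ) ^ 2) ≤ 1 := by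
  have hx0 : 0 ≤ x := by linarith
  set a : ℕ → ℝ := fun n => ‖χ (n : ZMod D)‖ * ((Nat.totient n : ℝ) / (n : ℝ) ^ 2) with ha
  have ha0 : ∀ n, 0 ≤ a n := fun n => by rw [ha]; positivity
  have ha1 : ∀ n, a n ≤ 1 := by
    intro n
    rw [ha]
    have h1 : ‖χ (n : ZMod D)‖ ≤ 1 := χ.norm_le_one _
    have h2 : (Nat.totient n : ℝ) / (n : ℝ) ^ 2 ≤ 1 := by
      rcases Nat.eq_zero_or_pos n with rfl | hn
      · simp
      · have hφ : (Nat.totient n : ℝ) ≤ n := by exact_mod_cast Nat.totient_le n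
        have hn1 : (1 : ℝ) ≤ n := by exact_mod_cast hn
        rw [div_le_one (by positivity)]
        nlinarith
    have h3 : 0 ≤ (Nat.totient n : ℝ) / (n : ℝ) ^ 2 := by positivity
    calc ‖χ (n : ZMod D)‖ * ((Nat.totient n : ℝ) / (n : ℝ) ^ 2) ≤ 1 * 1 := by gcongr
      _ = 1 := by ring
  have hS1 : (∑ n ∈ Finset.Icc 1 ⌊x⌋₊, ‖χ n‖ * ((Nat.totient n : ℝ) / (n : ℝ) ^ 2)) =
      ∑ n ∈ Finset.Icc 1 ⌊x⌋₊, a n := rfl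
  have hS2 : (∑ n ∈ Finset.Ico 1 ⌈x⌉₊, ‖χ (n : ZMod D)‖ * (Nat.totient n : ℝ) / (n : ℝ) ^ 2) =
      ∑ n ∈ Finset.Ico 1 ⌈x⌉₊, a n := Finset.sum_congr rfl fun n _ => by rw [ha, mul_div_assoc]
  rw [hS1, hS2]
  have hsub : Finset.Ico 1 ⌈x⌉₊ ⊆ Finset.Icc 1 ⌊x⌋₊ := by
    intro n hn
    rw [Finset.mem_Ico] at hn
    rw [Finset.mem_Icc]
    refine ⟨hn.1, Nat.le_floor ?_⟩
    exact (Nat.lt_ceil.mp hn.2).le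
  rw [← Finset.sum_sdiff hsub, add_sub_cancel_right]
  refine ⟨Finset.sum_nonneg fun n _ => ha0 n, ?_⟩
  -- the difference set is contained in `{⌊x⌋}`
  have hdiff : Finset.Icc 1 ⌊x⌋₊ \ Finset.Ico 1 ⌈x⌉₊ ⊆ {⌊x⌋₊} := by
    intro n hn
    rw [Finset.mem_sdiff, Finset.mem_Icc, Finset.mem_Ico, not_and, not_lt] at hn
    rw [Finset.mem_singleton]
    obtain ⟨⟨hn1, hnx⟩, h⟩ := hn
    have hcn : ⌈x⌉₊ ≤ n := h hn1
    have hxn : x ≤ n := Nat.ceil_le.mp hcn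
    have hnx' : (n : ℝ) ≤ x := by
      have := Nat.floor_le hx0
      calc (n : ℝ) ≤ ⌊x⌋₊ := by exact_mod_cast hnx
        _ ≤ x := this
    have hxe : (n : ℝ) = x := le_antisymm hnx' hxn
    have : ⌊x⌋₊ = n := by rw [← hxe, Nat.floor_natCast]
    exact this.symm
  calc ∑ n ∈ Finset.Icc 1 ⌊x⌋₊ \ Finset.Ico 1 ⌈x⌉₊, a n ≤ ∑ n ∈ {⌊x⌋₊}, a n :=
      Finset.sum_le_sum_of_subset_of_nonneg hdiff fun n _ _ => ha0 n
    _ = a ⌊x⌋₊ := Finset.sum_singleton _ _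
    _ ≤ 1 := ha1 _

/-- **`Z22:§8.u048` with the error `24𝓛²` in place of the printed `O(log 𝓛)`** — the form the
tree proves (`Sieve.CoprimeTotient.abs_sum_norm_mul_totient_div_sq_sub_le`, error
`3(1 + log D)² + 11`, uniformly in `x ≥ 1`, no upper limit on `x` needed), restated on the typed
sum of `Section8cStatements.Step8u048`. This is all that the consumer (8.11) uses (any error
`o(𝓛⁹)` is `o(α)` after the partial integration); the printed `O(log 𝓛)` is NOT proved here. [cite: Zhang2022LandauSiegel, §8 p.48 display before (8.11), tex L2463] -/
theorem step8u048_weak : ∃ C : ℝ, ForAllLarge fun D _ χ =>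
    ∀ x : ℝ, 1 ≤ x → x < bigP D →
      |(∑ n ∈ Finset.Ico 1 ⌈x⌉₊, ‖χ (n : ZMod D)‖ * (Nat.totient n : ℝ) / (n : ℝ) ^ 2) -
          6 / π ^ 2 * (∏ q ∈ D.primeFactors, (q : ℝ) / (q + 1)) * Real.log x|
        ≤ C * ell D ^ 2 := by
  refine ⟨24, 3, fun D _ χ hD _ _ x hx _ => ?_⟩
  have hD0 : D ≠ 0 := by omega
  have h := Literature.NumberTheory.Sieve.CoprimeTotient.abs_sum_norm_mul_totient_div_sq_sub_le
    hD0 χ hx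
  rw [Literature.NumberTheory.Sieve.CoprimeTotient.totientLogDensity_def] at h
  obtain ⟨h0, h1⟩ := sum_Icc_floor_sub_sum_Ico_ceil χ hx
  have hD3 : (3 : ℝ) ≤ D := by exact_mod_cast hD
  have hL1 : 1 ≤ ell D := by
    rw [ell]
    have : Real.exp 1 ≤ (D : ℝ) := le_trans (le_of_lt Real.exp_one_lt_d9) (by linarith)
    exact (Real.le_log_iff_exp_le (by linarith)).mpr this
  rw [show Real.log (D : ℝ) = ell D from rfl] at h
  have hbound : 3 * (1 + ell D) ^ 2 + 11 + 1 ≤ 24 * ell D ^ 2 := by nlinarith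
  rw [abs_le] at h ⊢
  constructor <;> linarith [h.1, h.2]

end Literature.NumberTheory.LFunctions.Zhang2022.Section8cProofs
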